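import Summits.BirchSwinnertonDyer.Rank1Residual.PrintX8.CertificateHeegnerIndex
import Summits.BirchSwinnertonDyer.Rank1Residual.Supersingular.CyclicityLadder
import HarnessLib

/-!
# Leaf X8, print-tier cell `bsd-print-x8` — addendum to the two-engine HEEGNER-INDEX rows: the kernel certificate
# «the recorded point `P ∈ F(ℚ)` is NOT `3`-divisible in `F̃(𝔽_ℓ)`» (division-free double-and-add ladder at one small
# good prime `ℓ`) and «`F̃(𝔽_ℓ′)` has no `3`-torsion» (point count at a second good prime), which make the `3`-SATURATION of
# `P` — the load-bearing engine datum behind `v = ord₃ m` — a kernel statement (schema `HISatRow`; rows in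
# `CertificateHeegnerIndexSatRecords.lean`)

HONEST FRAMING (cell `bsd-print-x8`, run/shared/lean/pub/bsd-print-x8/, D-0131 (2) PRINT TIER, typer seat ty3 gen 5; leaf
`Rank1Residual.ClassX8 W p := p = 3 ∧ GoodSS W 3 ∧ a_3 ≠ 0`): the leaf counts only when its CLASS THEOREM is in the kernel BY NAME,
flag-free (PARTITION currency, D-0132). THIS FILE IS DATA INFRASTRUCTURE: one record type, its decidable check, unpacking lemmas
and two reading theorems about the REDUCED curve over `ZMod ℓ` (Mathlib's group law); nothing about any elliptic curve over `ℚ`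
is asserted, no named fact is introduced, nothing is booked, BSD is proved for no curve. PARTITION: 0 cells. Pattern and purpose
= cell `bsd-print-cfram`'s `X12/CMRamifiedRecordSchemaGSat.lean` («the recorded generator is not `3`-divisible», Mordell curves,
chord–tangent law with `invMod`); here the curves are general five-coefficient models, so the arithmetic is the tree's
DIVISION-FREE LADDER `Supersingular/CyclicityLadder.lean` (`LadderStep`, `ladderCheck`, soundness `ladderRun_sound`) and the
tree's kernel point count `countPointsFast` (`Supersingular/CountPointsFast.lean`, `= countPoints`,
`natCard_point_eq_of_countPoints`).

WHY (lit DOSSIER v2.3 §5 item 60; ref R-84). In an `HIRow` of `PrintX8/CertificateHeegnerIndex.lean` (58 rank-`0` small-image X8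
cells, `CertificateHeegnerIndexRecords{A,B}.lean`) the index `m = [E(K) : ℤ y_K]` is the two engines' `√(4ρ)`,
`ρ = ĥ(y_K)/ĥ(P)` for ONE rational point `P = (PX/Pd², PY/Pd³)` of the rank-one twist `F = E^D`; `HIRow.consistent` rechecks
`P ∈ F(ℚ)` exactly but takes «`P` has infinite order and is `3`-saturated in `F(ℚ)`» from engine 2 (`satWitness`, informational).
That bit is load-bearing for `v = ord₃ m`: writing `P = k·g + t` (`g` a generator modulo the torsion `T`, `t ∈ T`), the computed
`m` is the true index times `k` up to a `3`-unit, so `v` is right iff `3 ∤ k`; and `3 ∤ k ⟸ (P ∉ 3·F(ℚ) ∧ F(ℚ)[3] = 0)`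
(if `3 ∣ k` then `P − t ∈ 3F(ℚ)` and `t ∈ 3T` as `#T` is prime to `3`). Both conjuncts follow from finite-field statements that
the kernel can decide:
* `P ∉ 3·F(ℚ) ⟸ P̄ ∉ 3·F̃(𝔽_ℓ)` at ONE prime `ℓ ∤ Pd` of good reduction for the minimal model `F` (reduction modulo `ℓ` is a group
  homomorphism on `F(ℚ) = F₀(ℚ_ℓ) ∩ F(ℚ)`, [cite: SilvermanAEC2009, VII.2 Prop. 2.1]; the tree's general form is
  `Literature/NumberTheory/EllipticCurves/ReductionHomomorphism.lean`), and `P̄ ∉ 3·F̃(𝔽_ℓ) ⟸ (n/3)·P̄ ≠ O` where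
  `n = #F̃(𝔽_ℓ)`, `3 ∣ n` (if `P̄ = 3Q̄` then `(n/3)·P̄ = n·Q̄ = O` by Lagrange) — THIS implication is the reading theorem
  `HISatRow.not_three_nsmul_eq_of_check` below, a Mathlib statement about `(F mod ℓ).toAffine.Point`;
* `F(ℚ)[3] = 0 ⟸ 3 ∤ #F̃(𝔽_ℓ′)` at a prime `ℓ′ ≠ 3` of good reduction (prime-to-`ℓ′` torsion injects,
  [cite: SilvermanAEC2009, VII.3 Prop. 3.1(b)]) — the finite-field half is `HISatRow.nsmul_three_eq_zero_imp_of_check` below.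
(For these cells `F(ℚ)[3] = 0` also follows from the irreducibility of `E[3] ≅ F[3] ⊗ χ_D`; the count makes it a datum-free
recheck.) Consequently a torsion `P` is impossible too (`P ∈ T = 3T ⊆ 3F(ℚ)`), so the certificate also covers «`P` has infinite
order». NOT covered (still engine content): saturation at primes `≠ 3` (irrelevant to `v`), the heights, `L′(F,1)`, `rank F(ℚ) = 1`.

## What an `HISatRow` records and what the kernel rechecks (`HISatRow.check`)

The JOIN fields `label`, `(a1,…,a6) = Fainvs`, `PX, PY, Pd` are COPIED from the `HIRow` of the same label (`HISatRow.matchesHI`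
states the join; the referee byte-compares); the certificate fields are a prime `ell ≥ 5`, the reduced point `(x0, y0)`,
`n = #F̃(𝔽_ell)`, the ladder `steps : List LadderStep` for the scalar `n/3` from `(x0, y0)` (bits of `n/3` after the leading
one; tangent slope, doubled point, chord slope, sum — all reduced mod `ell`), and a second prime `ell′ ≥ 5` with `n′ = #F̃(𝔽_ell′)`.
RECHECKED (`decide`): `P ∈ F(ℚ)` exactly (`weierstrassEvalZ`); `ell` prime (trial division), `ell ≥ 5`, `ell ∤ Δ(F)`, `ell ∤ Pd`;
`x0·Pd² ≡ PX`, `y0·Pd³ ≡ PY (mod ell)` (so `(x0,y0) = P̄`); `countPointsFast F ell = n`, `3 ∣ n`, `3 ≤ n`,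
`ladderScalar 1 steps = n/3`, `ladderCheck F ell x0 y0 steps` (the point is on `F mod ell` and the ladder runs through generic
tangent/chord steps to an AFFINE point); `ell′` prime, `ell′ ≥ 5`, `ell′ ∤ Δ(F)`, `countPointsFast F ell′ = n′`, `3 ∤ n′`.
Rows: HOME/ty3 (cell folder) `hisat/rows.json`, generator `hisat/parse_search.py` + `gen_sat_records.py` (python replica of the
ladder semantics; the smallest working `ell`, `ell′` are used: `ell ∈ {5, …, 71}`, at most 4 ladder steps, `ell′ ≤ 23`).

References: [SilvermanAEC2009] J. H. Silverman, *The Arithmetic of Elliptic Curves*, 2nd ed. (2009), III.2.3 (group law),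
VII.2 Prop. 2.1, VII.3 Prop. 3.1; [Miller2011LMS] Thm. 5.4 (the consumer of `v`); [GrossZagier1986] I (6.5); cell b2b-bsdres
`Supersingular/CyclicityLadder.lean` (the ladder TOOL), cell bsd-print-cfram `X12/CMRamifiedRecordSchemaGSat.lean` (precedent).
-/

set_option autoImplicit false

namespace Summit.BirchSwinnertonDyer.Rank1Residual.PrintX8

open WeierstrassCurve
open Literature.NumberTheory.EllipticCurves.Rank1Residual.X11RankOneCertificates (countPoints discOf)
open Summit.BirchSwinnertonDyer.Rank1Residual.Supersingular
  (LadderStep ladderCheck ladderScalar ladderRun ladderRun_sound map_a_eq countPointsFast countPoints_eq_of_fast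
    natCard_point_eq_of_countPoints)
open Summit.BirchSwinnertonDyer.BirchSwinnertonDyer.Rank1Residual.HeegnerIndexRecords (isPrimeTD weierstrassEvalZ)
open Summit.BirchSwinnertonDyer.BirchSwinnertonDyer.Rank1Residual.X11RankOne (intCurve_Δ)

/-! ### §1 The record and its check -/

/-- One `3`-saturation certificate row for the point `P = (PX/Pd², PY/Pd³)` of the twist `F = [a1,a2,a3,a4,a6]` recorded in the
`HIRow` of the same `label` (module docstring). Asserts nothing; `HISatRow.check` is its decidable recheck. [folklore] -/
structure HISatRow where
  /-- Cremona label of the X8 cell (join key with `HIRow.label`). -/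
  label : String
  /-- `a₁` of the minimal model of `F = E^D` (`= HIRow.Fainvs[0]`). -/
  a1 : ℤ
  /-- `a₂`. -/
  a2 : ℤ
  /-- `a₃`. -/
  a3 : ℤ
  /-- `a₄`. -/
  a4 : ℤ
  /-- `a₆`. -/
  a6 : ℤ
  /-- `P = (PX/Pd², PY/Pd³) ∈ F(ℚ)` (`= HIRow.PX`). -/
  PX : ℤ
  /-- see `PX`. -/
  PY : ℤ
  /-- see `PX`. -/
  Pd : ℕ
  /-- the certificate prime `ℓ ≥ 5`, `ℓ ∤ Δ(F)·Pd`. -/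
  ell : ℕ
  /-- `x(P̄) ∈ [0, ℓ)`. -/
  x0 : ℤ
  /-- `y(P̄) ∈ [0, ℓ)`. -/
  y0 : ℤ
  /-- `n = #F̃(𝔽_ℓ)` (`3 ∣ n`). -/
  n : ℕ
  /-- the double-and-add ladder for `(n/3)·P̄` (tree `Supersingular.LadderStep`). -/
  steps : List LadderStep
  /-- the second prime `ℓ′ ≥ 5`, `ℓ′ ∤ Δ(F)`, with `3 ∤ #F̃(𝔽_ℓ′)`. -/
  ell' : ℕ
  /-- `n′ = #F̃(𝔽_ℓ′)`. -/
  n' : ℕ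

namespace HISatRow

variable (s : HISatRow)

/-- The a-invariants as a list (the `HIRow.Fainvs` shape). [folklore] -/
def ainvs : List ℤ := [s.a1, s.a2, s.a3, s.a4, s.a6]

/-- The integral Weierstrass model `F`. [folklore] -/
def curve : WeierstrassCurve ℤ := ⟨s.a1, s.a2, s.a3, s.a4, s.a6⟩

/-- JOIN with a Heegner-index row: same label, same twist model, same point. [folklore] -/
def matchesHI (r : HIRow) : Bool :=
  (s.label == r.label) && (s.ainvs == r.Fainvs) && (s.PX == r.PX) && (s.PY == r.PY) && (s.Pd == r.Pd)

/-- `P ∈ F(ℚ)` exactly (weighted integral coordinates). [folklore] -/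
def checkPoint : Bool := decide (1 ≤ s.Pd) && (weierstrassEvalZ s.ainvs s.PX s.PY s.Pd == 0)

/-- The certificate prime: `ℓ` prime, `ℓ ≥ 5`, good for `F` (`ℓ ∤ Δ`), `ℓ ∤ Pd`, and `(x0, y0) ≡ (PX/Pd², PY/Pd³) (mod ℓ)`,
normalised to `[0, ℓ)`. [folklore] -/
def checkPrime : Bool :=
  isPrimeTD s.ell && decide (5 ≤ s.ell) && (discOf s.ainvs % (s.ell : ℤ) != 0) && (s.Pd % s.ell != 0) &&
  ((s.x0 * (s.Pd : ℤ) ^ 2 - s.PX) % (s.ell : ℤ) == 0) && ((s.y0 * (s.Pd : ℤ) ^ 3 - s.PY) % (s.ell : ℤ) == 0) &&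
  decide (0 ≤ s.x0) && decide (s.x0 < s.ell) && decide (0 ≤ s.y0) && decide (s.y0 < s.ell)

/-- The count and the ladder at `ℓ`: `#F̃(𝔽_ℓ) = n` (tree `countPointsFast`), `3 ∣ n`, `3 ≤ n`, the ladder computes the scalar
`n/3` and runs from `P̄ = (x0, y0)` to an affine point (tree `ladderCheck`). [cite: SilvermanAEC2009, III.2.3] -/
def checkLadder : Bool :=
  (countPointsFast s.ainvs s.ell == (s.n : ℤ)) && (s.n % 3 == 0) && decide (3 ≤ s.n) &&
  (ladderScalar 1 s.steps == s.n / 3) && ladderCheck s.curve s.ell s.x0 s.y0 s.steps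

/-- The second prime: `ℓ′` prime, `ℓ′ ≥ 5`, good for `F`, `#F̃(𝔽_ℓ′) = n′` with `3 ∤ n′`. [folklore] -/
def checkPrime' : Bool :=
  isPrimeTD s.ell' && decide (5 ≤ s.ell') && (discOf s.ainvs % (s.ell' : ℤ) != 0) &&
  (countPointsFast s.ainvs s.ell' == (s.n' : ℤ)) && (s.n' % 3 != 0)

/-- The full recheck of a row. [folklore] -/
def check : Bool := s.checkPoint && s.checkPrime && s.checkLadder && s.checkPrime'

/-! ### §2 Unpacking -/

/-- `check` unpacked into its four blocks. [folklore] -/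
theorem check_iff : s.check = true ↔
    s.checkPoint = true ∧ s.checkPrime = true ∧ s.checkLadder = true ∧ s.checkPrime' = true := by
  simp only [check, Bool.and_eq_true]; tauto

/-- From `checkPrime`: `5 ≤ ℓ`, `ℓ ∤ Δ(F)`, `ℓ ∤ Pd` and the congruences `x0·Pd² ≡ PX`, `y0·Pd³ ≡ PY (mod ℓ)`. [folklore] -/
theorem of_checkPrime (h : s.checkPrime = true) :
    5 ≤ s.ell ∧ ¬ (s.ell : ℤ) ∣ discOf s.ainvs ∧ ¬ s.ell ∣ s.Pd ∧
      (s.ell : ℤ) ∣ s.x0 * (s.Pd : ℤ) ^ 2 - s.PX ∧ (s.ell : ℤ) ∣ s.y0 * (s.Pd : ℤ) ^ 3 - s.PY := by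
  simp only [checkPrime, Bool.and_eq_true, decide_eq_true_eq, bne_iff_ne, ne_eq, beq_iff_eq] at h
  obtain ⟨⟨⟨⟨⟨⟨⟨⟨⟨-, h5⟩, hΔ⟩, hd⟩, hx⟩, hy⟩, -⟩, -⟩, -⟩, -⟩ := h
  exact ⟨h5, fun hdvd => hΔ (Int.emod_eq_zero_of_dvd hdvd), fun hdvd => hd (Nat.mod_eq_zero_of_dvd hdvd),
    Int.dvd_of_emod_eq_zero hx, Int.dvd_of_emod_eq_zero hy⟩

/-- From `checkLadder`: the schema count `countPoints F ℓ = n`, `3 ∣ n`, `3 ≤ n`, the ladder scalar is `n/3`, and the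
ladder check holds. [folklore] -/
theorem of_checkLadder (h : s.checkLadder = true) :
    countPoints [s.a1, s.a2, s.a3, s.a4, s.a6] s.ell = (s.n : ℤ) ∧ 3 ∣ s.n ∧ 3 ≤ s.n ∧ ladderScalar 1 s.steps = s.n / 3 ∧
      ladderCheck s.curve s.ell s.x0 s.y0 s.steps = true := by
  simp only [checkLadder, Bool.and_eq_true, decide_eq_true_eq, beq_iff_eq] at h
  obtain ⟨⟨⟨⟨hc, h3⟩, h3'⟩, hm⟩, hl⟩ := h
  exact ⟨countPoints_eq_of_fast hc, Nat.dvd_of_mod_eq_zero h3, h3', hm, hl⟩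

/-- From `checkPrime'`: `5 ≤ ℓ′`, `ℓ′ ∤ Δ(F)`, `countPoints F ℓ′ = n′`, `3 ∤ n′`. [folklore] -/
theorem of_checkPrime' (h : s.checkPrime' = true) :
    5 ≤ s.ell' ∧ ¬ (s.ell' : ℤ) ∣ discOf s.ainvs ∧ countPoints [s.a1, s.a2, s.a3, s.a4, s.a6] s.ell' = (s.n' : ℤ) ∧
      ¬ 3 ∣ s.n' := by
  simp only [checkPrime', Bool.and_eq_true, decide_eq_true_eq, bne_iff_ne, ne_eq, beq_iff_eq] at h
  obtain ⟨⟨⟨⟨-, h5⟩, hΔ⟩, hc⟩, h3⟩ := h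
  exact ⟨h5, fun hdvd => hΔ (Int.emod_eq_zero_of_dvd hdvd), countPoints_eq_of_fast hc, fun hdvd => h3 (Nat.mod_eq_zero_of_dvd hdvd)⟩

/-! ### §3 The two reading theorems (Mathlib statements about `F mod ℓ`) -/

/-- The reduced curve `F mod ℓ` (Mathlib). [folklore] -/
abbrev red (ℓ : ℕ) : WeierstrassCurve (ZMod ℓ) := s.curve.map (Int.castRingHom (ZMod ℓ))

/-- **The point `P̄ = (x0, y0)` of `F̃(𝔽_ℓ)` is NOT `3`-divisible in `F̃(𝔽_ℓ)`**: a checked row gives the nonsingularity of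
`(x0, y0)` on `F mod ℓ` and `3 • Q ≠ P̄` for every `Q ∈ F̃(𝔽_ℓ)` — because `(n/3) • P̄` is an affine point by the ladder
(`ladderRun_sound`) while `(n/3) • (3 • Q) = n • Q = O` (`#F̃(𝔽_ℓ) = n` by `natCard_point_eq_of_countPoints`). With the
reduction homomorphism `F(ℚ) → F̃(𝔽_ℓ)` (`ℓ ∤ Δ(F)·Pd`, so `P ↦ P̄`) this is `P ∉ 3·F(ℚ)` (module docstring).
[cite: SilvermanAEC2009, III.2.3 and VII.2 Prop. 2.1] -/
theorem not_three_nsmul_eq_of_check (h : s.check = true) [Fact s.ell.Prime] :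
    ∃ h₀ : (s.red s.ell).toAffine.Nonsingular (s.x0 : ZMod s.ell) (s.y0 : ZMod s.ell),
      ∀ Q : (s.red s.ell).toAffine.Point, 3 • Q ≠ Affine.Point.some (s.x0 : ZMod s.ell) (s.y0 : ZMod s.ell) h₀ := by
  obtain ⟨-, hP, hL, -⟩ := s.check_iff.mp h
  obtain ⟨h5, hΔ, -, -, -⟩ := s.of_checkPrime hP
  obtain ⟨hcount, h3n, h3le, hm, hlad⟩ := s.of_checkLadder hL
  have hℓ2 : s.ell ≠ 2 := by omega
  have hΔ' : ¬ (s.ell : ℤ) ∣ discOf [s.a1, s.a2, s.a3, s.a4, s.a6] := hΔ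
  have hcard : Nat.card (s.red s.ell).toAffine.Point = s.n :=
    natCard_point_eq_of_countPoints s.a1 s.a2 s.a3 s.a4 s.a6 s.ell hℓ2 hΔ' hcount
  have hΔV : ¬ (s.ell : ℤ) ∣ s.curve.Δ := by
    show ¬ (s.ell : ℤ) ∣ (⟨s.a1, s.a2, s.a3, s.a4, s.a6⟩ : WeierstrassCurve ℤ).Δ
    rw [intCurve_Δ]; exact hΔ'
  obtain ⟨ha₁, ha₂, ha₃, ha₄, ha₆⟩ := map_a_eq s.curve s.ell
  simp only [ladderCheck, Bool.and_eq_true, decide_eq_true_eq, Option.isSome_iff_exists] at hlad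
  obtain ⟨heq, ⟨xf, yf⟩, hrun⟩ := hlad
  have hΔne : (s.red s.ell).toAffine.Δ ≠ 0 := by
    intro h0
    have h' : ((s.curve.Δ : ℤ) : ZMod s.ell) = 0 := by
      have := (s.curve.map_Δ (Int.castRingHom (ZMod s.ell))).symm.trans h0
      simpa using this
    exact hΔV ((ZMod.intCast_zmod_eq_zero_iff_dvd _ _).mp h')
  have h₀ : (s.red s.ell).toAffine.Nonsingular (s.x0 : ZMod s.ell) (s.y0 : ZMod s.ell) := by
    refine (Affine.equation_iff_nonsingular_of_Δ_ne_zero hΔne).mp ((Affine.equation_iff _ _).mpr ?_)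
    rw [ha₁, ha₂, ha₃, ha₄, ha₆]; exact heq
  refine ⟨h₀, ?_⟩
  obtain ⟨hf, hP0⟩ := ladderRun_sound h₀ s.steps 1 _ _ h₀ (one_nsmul _) xf yf hrun
  rw [hm] at hP0
  intro Q hQ
  haveI : Finite (s.red s.ell).toAffine.Point := Nat.finite_of_card_ne_zero (by rw [hcard]; omega)
  have hkill : s.n • Q = 0 :=
    addOrderOf_dvd_iff_nsmul_eq_zero.mp (hcard ▸ addOrderOf_dvd_natCard Q)
  have hzero : (s.n / 3) • (Affine.Point.some (s.x0 : ZMod s.ell) (s.y0 : ZMod s.ell) h₀ : (s.red s.ell).toAffine.Point) = 0 := by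
    rw [← hQ, ← mul_nsmul', Nat.div_mul_cancel h3n, hkill]
  rw [hzero] at hP0
  exact (Affine.Point.some_ne_zero hf) hP0.symm

/-- **`F̃(𝔽_ℓ′)` has no `3`-torsion**: a checked row gives `3 • Q = 0 → Q = 0` on `F mod ℓ′` (`#F̃(𝔽_ℓ′) = n′`, `3 ∤ n′`).
With the injectivity of prime-to-`ℓ′` torsion under reduction this is `F(ℚ)[3] = 0` (module docstring).
[cite: SilvermanAEC2009, VII.3 Prop. 3.1(b)] -/
theorem nsmul_three_eq_zero_imp_of_check (h : s.check = true) [Fact s.ell'.Prime] :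
    ∀ Q : (s.red s.ell').toAffine.Point, 3 • Q = 0 → Q = 0 := by
  obtain ⟨-, -, -, hP'⟩ := s.check_iff.mp h
  obtain ⟨h5, hΔ, hcount, h3⟩ := s.of_checkPrime' hP'
  have hℓ2 : s.ell' ≠ 2 := by omega
  have hΔ' : ¬ (s.ell' : ℤ) ∣ discOf [s.a1, s.a2, s.a3, s.a4, s.a6] := hΔ
  have hcard : Nat.card (s.red s.ell').toAffine.Point = s.n' :=
    natCard_point_eq_of_countPoints s.a1 s.a2 s.a3 s.a4 s.a6 s.ell' hℓ2 hΔ' hcount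
  intro Q hQ
  haveI : Finite (s.red s.ell').toAffine.Point := Nat.finite_of_card_ne_zero (by
    rw [hcard]; rintro h0; exact h3 (h0 ▸ dvd_zero 3))
  have h1 : addOrderOf Q ∣ 3 := addOrderOf_dvd_iff_nsmul_eq_zero.mpr hQ
  rcases (Nat.dvd_prime Nat.prime_three).mp h1 with h1 | h1
  · exact AddMonoid.addOrderOf_eq_one_iff.mp h1
  · exact absurd (h1 ▸ hcard ▸ addOrderOf_dvd_natCard Q) h3

end HISatRow

/-! ### §4 The display check -/

/-- Display check: every row passes `HISatRow.check` and the row count is as stated (the statement of each data theorem of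
`CertificateHeegnerIndexSatRecords.lean`, proved by `decide`). [folklore] -/
def hiSatCheck (rs : List HISatRow) (k : ℕ) : Bool := rs.all HISatRow.check && (rs.length == k)

/-- Unpacking a display theorem per row. [folklore] -/
theorem HISatRow.check_of_hiSatCheck {rs : List HISatRow} {k : ℕ} (h : hiSatCheck rs k = true) {s : HISatRow}
    (hs : s ∈ rs) : s.check = true := by
  simp only [hiSatCheck, Bool.and_eq_true] at h
  exact List.all_eq_true.1 h.1 s hs

/-- The row count of a checked display. [folklore] -/
theorem length_eq_of_hiSatCheck {rs : List HISatRow} {k : ℕ} (h : hiSatCheck rs k = true) : rs.length = k := by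
  simp only [hiSatCheck, Bool.and_eq_true, beq_iff_eq] at h
  exact h.2

/-! ### §5 Sample -/

/-- The row of the H0 cell `135200bx1` (`F = E^{−191}`, `P` as in `certifiedHI_x8_smallImage_A1`; `ℓ = 23`, `#F̃(𝔽₂₃) = 18`,
`P̄ = (1, 18)`, ladder for `6 = 110₂`; `ℓ′ = 7`, `#F̃(𝔽₇) = 7`). [folklore] -/
def sampleRow_135200bx1 : HISatRow :=
  { label := "135200bx1", a1 := 0, a2 := 0, a3 := 0, a4 := (-14026032475), a6 := (-646780431800750),
    PX := 9919331502790489, PY := 972847451547727778831237, Pd := 118830, ell := 23, x0 := 1, y0 := 18, n := 18,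
    steps := [⟨true, 11, 4, 18, 0, 18, 5⟩, ⟨false, 10, 18, 18, 0, 0, 0⟩], ell' := 7, n' := 7 }

/-- Sanity (kernel `decide`): the sample row passes `HISatRow.check`. [folklore] -/
theorem sampleRow_135200bx1_check : sampleRow_135200bx1.check = true := by
  decide +kernel

/-- Tamper (kernel `decide`): replacing `P̄ = (1, 18)` by its negative `(1, 5)` — still a point of `F̃(𝔽₂₃)`, and the
congruence `y0·Pd³ ≡ PY` then fails too — is REJECTED: the ladder's supplied slopes no longer verify. [folklore] -/
theorem sampleRow_135200bx1_tamper : { sampleRow_135200bx1 with y0 := 5 }.check = false := by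
  decide +kernel

/-- Sanity: the sample row's reading — `P̄ = (1, 18) ∈ F̃(𝔽₂₃)` is not `3`-divisible (`F = E^{−191}` of `135200bx1`). [folklore] -/
theorem sampleRow_135200bx1_not_three_nsmul [h23 : Fact (Nat.Prime 23)] :
    ∃ h₀ : (sampleRow_135200bx1.red 23).toAffine.Nonsingular ((1 : ℤ) : ZMod 23) ((18 : ℤ) : ZMod 23),
      ∀ Q : (sampleRow_135200bx1.red 23).toAffine.Point, 3 • Q ≠ Affine.Point.some _ _ h₀ :=
  @HISatRow.not_three_nsmul_eq_of_check sampleRow_135200bx1 sampleRow_135200bx1_check h23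

end Summit.BirchSwinnertonDyer.Rank1Residual.PrintX8
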